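import Summits.Ventures.CertifiedArithmetic.Expansions.Orient2dTailsZeroPin
import Summits.Ventures.CertifiedArithmetic.Expansions.Orient2dEstimateZero
import Literature.ComputerArithmetic.RumpOgitaOishi2008.TransformFinal
import Literature.ComputerArithmetic.BoldoMuller2011.ErrFmaAppr
import Literature.ComputerArithmetic.Shewchuk1997.ScaleExpansion
import Literature.ComputerArithmetic.BoldoJeannerodMelquiondMuller2023.TwoProdDirected

/-!
# ORIENT2D, the tails-zero exit without the range threshold

NEW WORK in the sense of this development (statement and proof ours; no published counterpart
claimed). `Orient2dTailsZero` proved that at the exit `if ((acxtail == 0.0) && …) return det;` of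
Shewchuk's `orient2dadapt` [Shewchuk1997, Fig. 21 / predicates.c] a returned `det = estimate(B) = 0`
forces the true determinant to be `0`, for error-free two-products whose ROUNDED PRODUCTS ARE AT
LEAST `2^(emin+2p+2)`. This file removes that threshold: only positivity of the two rounded products
is kept (`p ≥ 4`, any round-to-nearest; the block form needs `RoundoffBelow 2` as before), so the
conclusion holds throughout the gradual-underflow range too — where the substantive hypothesis is
the error-freeness of the two-products, assumed (not proved) here.

* `tailsZero_core_pos` — the chain lemma with `0 < A`, `0 < B` in place of the threshold. The
  threshold entered the landed proof twice: (a) to make `j` and `y = −i'` normal, so that the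
  grid-pinning lemma `grid_pin_float` applies, and (b) to make the float `V·(1 − 2^−p)` next to the
  pinned value `V ∈ {ulp(j), ulp(y)}` representable (`V ≥ 2^(emin+p)`). Both uses are replaced by a
  dichotomy. (a) If `j < 2^(emin+p)` then `ulp(j) = 2^emin`, and `j`, `y` are floats, hence
  multiples of `2^emin`, with `|j − y| < ulp(j)`: so `j = y`, i.e. `B₃ = 0` outright. Otherwise `j ≥
  2^(emin+p)` is normal and so is `y > j − ulp(j) ≥ (7/8)·j`. (b) If `V ≤ 2^(emin+p−1)` then `w = B₀
  + B₁` — a sum of two floats, so on the grid `2^emin`, and `|w| < V` — is itself a float, whence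
  `B₀ ⊕ B₁ = w`; but `B₀ ⊕ B₁ = −B₃ = ±V` has magnitude `V > |w|`. The rest is the landed argument
  verbatim.

* `twoTwoProdDiff_estimate_eq_zero_sum_pos`, `orient2d_tailsZero_det_eq_zero_pos` — the block form
  and the `orient2dadapt` form with `0 < fl (x₁x₂)`, `0 < fl (x₃x₄)`; the landed threshold versions
  are special cases (that file is not imported; this one is self-contained over the same
  prerequisites).

Evidence gathered before the proof (exact integer model `F(p, 0)`, round-to-nearest-even, all pairs
of error-free two-products of positive floats up to `(2^p − 1)·2^(p+1)` — rounded products from `1`,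
deep in the gradual-underflow range, to far above the old threshold): for `p = 2, 3, 4, 5` (up to
2461761 pairs) `estimate(B) = 0` happens exactly on the diagonal (equal products), never with a
nonzero difference.
-/

namespace Summit.Ventures.CertifiedArithmetic.Expansions

open Literature.ComputerArithmetic.JeannerodRump2018
open Literature.ComputerArithmetic.BoldoJeannerodMelquiondMuller2023 hiding twoSum twoSum_fst
  isFloat_twoSum
open Literature.ComputerArithmetic.Shewchuk1997
open Literature.ComputerArithmetic.RumpOgitaOishi2008 (add_eq_zero_of_fl_add_eq_zero)
open Literature.ComputerArithmetic.BoldoMuller2011 (unitRoundoff_le_sixteenth)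

variable {p : ℕ} {emin : ℤ} {fl : ℚ → ℚ}

/-- **THE CORE, WITHOUT THE RANGE THRESHOLD.** As `Orient2dTailsZero.tailsZero_core`, with the
hypotheses `2^(emin+2p+2) ≤ A, B` replaced by `0 < A`, `0 < B`. See the module docstring. -/
theorem tailsZero_core_pos (hp : 4 ≤ p) (hfl : IsRoundNearest p emin fl)
    {A a₀ B b₀ i j i' : ℚ} (hFA : IsFloat p emin A) (hFa : IsFloat p emin a₀)
    (hFB : IsFloat p emin B) (hFb : IsFloat p emin b₀)
    (hAe : fl (A + a₀) = A) (hBe : fl (B + b₀) = B)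
    (hApos : 0 < A) (hBpos : 0 < B)
    (hi : fl (-b₀ + a₀) = i) (hj : fl (i + A) = j) (hi' : fl (-B + (i + A - j)) = i')
    (hQ : fl ((-b₀ + a₀ - i) + (-B + (i + A - j) - i')) = -(i' + j)) :
    i' + j = 0 := by
  by_contra hne
  have hp1 : 1 ≤ p := (by omega); have hp2 : 2 ≤ p := by omega
  set u := unitRoundoff p with hu
  have hu0 : 0 < u := by rw [hu]; unfold unitRoundoff; positivity
  have hu16 : u ≤ 1 / 16 := unitRoundoff_le_sixteenth hp
  -- |fl (a + b) − (a + b)| ≤ u·|a + b| for floats a, b (from the sharp bound u/(1+u))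
  have aeu : ∀ {a b : ℚ}, IsFloat p emin a → IsFloat p emin b →
      |fl (a + b) - (a + b)| ≤ u * |a + b| := fun ha hb =>
    (abs_err_add_le_sharp hp1 hfl ha hb).trans
      (mul_le_mul_of_nonneg_right (div_le_self hu0.le (by linarith)) (abs_nonneg _))
  have h2 : (0 : ℚ) < 2 := by norm_num
  set B₀ := -b₀ + a₀ - i with hB₀
  set z₀ := i + A - j with hz₀
  set B₁ := -B + z₀ - i' with hB₁
  set w := B₀ + B₁ with hw
  have hFi : IsFloat p emin i := hi ▸ (hfl _).1; have hFj : IsFloat p emin j := hj ▸ (hfl _).1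
  have hFi' : IsFloat p emin i' := hi' ▸ (hfl _).1
  have hFB₀ : IsFloat p emin B₀ := by
    have h := (twoSum_exact hp1 hfl hFb.neg hFa).1
    have hF := (isFloat_twoSum hfl (-b₀) a₀).2
    rw [h, hi] at hF
    exact hF
  have hFz : IsFloat p emin z₀ := by
    have h := (twoSum_exact hp1 hfl hFi hFA).1
    have hF := (isFloat_twoSum hfl i A).2
    rw [h, hj] at hF
    exact hF
  have hFB₁ : IsFloat p emin B₁ := by
    have h := (twoSum_exact hp1 hfl hFB.neg hFz).1
    have hF := (isFloat_twoSum hfl (-B) z₀).2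
    rw [h, hi'] at hF
    exact hF
  have ha₀ : |a₀| ≤ u * A := by
    have h := abs_err_add_le_sharp hp1 hfl hFA hFa
    rw [hAe, show A - (A + a₀) = -a₀ by ring, abs_neg, div_mul_eq_mul_div,
      le_div_iff₀ (by linarith)] at h
    have hA' : |A + a₀| ≤ A + |a₀| := by
      calc |A + a₀| ≤ |A| + |a₀| := abs_add_le _ _
        _ = A + |a₀| := by rw [abs_of_pos hApos]
    linarith [mul_le_mul_of_nonneg_left hA' hu0.le, abs_nonneg a₀]
  have hb₀ : |b₀| ≤ u * B := by
    have h := abs_err_add_le_sharp hp1 hfl hFB hFb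
    rw [hBe, show B - (B + b₀) = -b₀ by ring, abs_neg, div_mul_eq_mul_div,
      le_div_iff₀ (by linarith)] at h
    have hB' : |B + b₀| ≤ B + |b₀| := by
      calc |B + b₀| ≤ |B| + |b₀| := abs_add_le _ _
        _ = B + |b₀| := by rw [abs_of_pos hBpos]
    linarith [mul_le_mul_of_nonneg_left hB' hu0.le, abs_nonneg b₀]
  have hB₀u : |B₀| ≤ u * (|a₀| + |b₀|) := by
    have h := aeu hFb.neg hFa
    rw [hi, abs_sub_comm] at h
    have h' : |(-b₀) + a₀| ≤ |a₀| + |b₀| := by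
      calc |(-b₀) + a₀| ≤ |-b₀| + |a₀| := abs_add_le _ _
        _ = |a₀| + |b₀| := by rw [abs_neg, add_comm]
    exact h.trans (mul_le_mul_of_nonneg_left h' hu0.le)
  have hz₀u : |z₀| ≤ u * (|i| + A) := by
    have h := aeu hFi hFA
    rw [hj, abs_sub_comm] at h
    have h' : |i + A| ≤ |i| + A := by
      calc |i + A| ≤ |i| + |A| := abs_add_le _ _
        _ = |i| + A := by rw [abs_of_pos hApos]
    exact h.trans (mul_le_mul_of_nonneg_left h' hu0.le)
  have hz₀j : |z₀| ≤ ulp p emin j / 2 := by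
    have h := abs_sub_fl_le_half_ulp_fl hp1 hfl (i + A)
    rwa [hj] at h
  have hB₁z : |B₁| ≤ |z₀| := by
    have h := abs_err_le_abs_operand hfl hFB.neg z₀
    rwa [hi', abs_sub_comm] at h
  have hB₁i' : |B₁| ≤ ulp p emin i' / 2 := by
    have h := abs_sub_fl_le_half_ulp_fl hp1 hfl (-B + z₀)
    rwa [hi'] at h
  have hB₃ : |i' + j| ≤ (1 + u) * (|B₀| + |B₁|) := by
    have h := aeu hFB₀ hFB₁
    rw [hQ] at h
    have hw' : |B₀ + B₁| ≤ |B₀| + |B₁| := abs_add_le _ _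
    have h1 : |-(i' + j) - (B₀ + B₁)| ≥ |i' + j| - |B₀ + B₁| := by
      have := abs_sub_abs_le_abs_sub (-(i' + j)) (B₀ + B₁)
      rw [abs_neg] at this
      linarith
    linarith [mul_le_mul_of_nonneg_left hw' hu0.le, abs_nonneg (B₀ + B₁)]
  have hi_le : |i| ≤ |a₀| + |b₀| + |B₀| := by
    have : i = a₀ + (-b₀) + (-B₀) := by rw [hB₀]; ring
    rw [this]
    calc |a₀ + -b₀ + -B₀| ≤ |a₀ + -b₀| + |-B₀| := abs_add_le _ _
      _ ≤ |a₀| + |-b₀| + |-B₀| := by linarith [abs_add_le a₀ (-b₀)]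
      _ = |a₀| + |b₀| + |B₀| := by rw [abs_neg, abs_neg]
  have ha₀' : |a₀| ≤ A / 16 := by
    linarith [mul_le_mul_of_nonneg_right hu16 hApos.le]
  have hb₀' : |b₀| ≤ B / 16 := by
    linarith [mul_le_mul_of_nonneg_right hu16 hBpos.le]
  have hB₀' : |B₀| ≤ (|a₀| + |b₀|) / 16 := by
    linarith [mul_le_mul_of_nonneg_right hu16 (by positivity : (0 : ℚ) ≤ |a₀| + |b₀|)]
  have hz₀' : |z₀| ≤ (|i| + A) / 16 := by
    linarith [mul_le_mul_of_nonneg_right hu16 (by positivity : (0 : ℚ) ≤ |i| + A)]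
  have hB₃' : |i' + j| ≤ 17 / 16 * (|B₀| + |B₁|) := by
    linarith [mul_le_mul_of_nonneg_right (by linarith : 1 + u ≤ 17 / 16)
      (by positivity : (0 : ℚ) ≤ |B₀| + |B₁|)]
  have ea₀ := abs_le.mp (le_refl |a₀|); have eb₀ := abs_le.mp (le_refl |b₀|)
  have eB₀ := abs_le.mp (le_refl |B₀|); have ez₀ := abs_le.mp (le_refl |z₀|)
  have eB₁ := abs_le.mp (le_refl |B₁|); have eB₃ := abs_le.mp (le_refl |i' + j|)
  have hidef : i = -b₀ + a₀ - B₀ := by rw [hB₀]; ring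
  have hjdef : j = i + A - z₀ := by rw [hz₀]; ring
  have hi'def : i' = -B + z₀ - B₁ := by rw [hB₁]; ring
  have hS1 : A + B ≤ 3 * j := by
    linarith [abs_nonneg a₀, abs_nonneg b₀, abs_nonneg B₀, abs_nonneg z₀, abs_nonneg B₁]
  have hjA : A ≤ 2 * j := by
    linarith [abs_nonneg a₀, abs_nonneg b₀, abs_nonneg B₀, abs_nonneg z₀, abs_nonneg B₁]
  have hyB : B ≤ 2 * (-i') := by
    linarith [abs_nonneg a₀, abs_nonneg b₀, abs_nonneg B₀, abs_nonneg z₀, abs_nonneg B₁]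
  have hj0 : 0 < j := by linarith
  set y := -i' with hy; have hy0 : 0 < y := by linarith
  have hFy : IsFloat p emin y := hFi'.neg
  have hulpj : u * j < ulp p emin j := by
    have h := abs_lt_two_pow_mul_ulp (p := p) (emin := emin) j
    rw [abs_of_pos hj0] at h
    rw [hu]; unfold unitRoundoff
    rw [one_div, inv_mul_eq_div, div_lt_iff₀ (by positivity)]
    linarith
  -- |B₀| < (3/16)·ulp(j), hence |B₃| < ulp(j)
  have hB₀j : |B₀| < 3 / 16 * ulp p emin j := by
    have h1 : |B₀| ≤ u * ((A + B) / 16) := by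
      calc |B₀| ≤ u * (|a₀| + |b₀|) := hB₀u
        _ ≤ u * ((A + B) / 16) := mul_le_mul_of_nonneg_left (by linarith) hu0.le
    have h2' : u * (A + B) ≤ u * (3 * j) := mul_le_mul_of_nonneg_left hS1 hu0.le
    linarith
  have hU0 : 0 < ulp p emin j := ulp_pos (p := p) (emin := emin) j
  have hB₃lt : |j - y| < ulp p emin j := by
    rw [hy, sub_neg_eq_add, add_comm]
    linarith [hB₁z.trans hz₀j, abs_nonneg B₀, abs_nonneg B₁]
  have hne' : j ≠ y := by
    intro h; apply hne; rw [hy] at h; linarith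
  -- j ≥ 2^(emin+p): else ulp(j) = 2^emin and j ≠ y on the grid 2^emin are ≥ 2^emin apart
  have hjn' : (2 : ℚ) ^ (emin + p) ≤ j := by
    by_contra hlt; rw [not_le] at hlt
    have hUle : ulp p emin j ≤ (2 : ℚ) ^ emin :=
      ulp_le_two_zpow_of_abs_lt le_rfl (by rw [abs_of_pos hj0, add_comm]; exact hlt)
    obtain ⟨J, hJ⟩ := hFj.exists_int_mul_zpow_emin
    obtain ⟨Y, hY⟩ := hFy.exists_int_mul_zpow_emin
    have he0 : (0 : ℚ) < (2 : ℚ) ^ emin := zpow_pos h2 _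
    have h1 : |((J - Y : ℤ) : ℚ)| * 2 ^ emin < 1 * 2 ^ emin := by
      have hjy : j - y = ((J - Y : ℤ) : ℚ) * 2 ^ emin := by rw [hJ, hY]; push_cast; ring
      calc |((J - Y : ℤ) : ℚ)| * 2 ^ emin = |j - y| := by rw [hjy, abs_mul, abs_of_pos he0]
        _ < ulp p emin j := hB₃lt
        _ ≤ 2 ^ emin := hUle
        _ = 1 * 2 ^ emin := (one_mul _).symm
    have h3 : |J - Y| < 1 := by exact_mod_cast (lt_of_mul_lt_mul_right h1 he0.le)
    have h4 : J = Y := by have := Int.abs_lt_one_iff.mp h3; omega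
    exact hne' (by rw [hJ, hY, h4])
  -- hence j and y are normal (y > j − ulp(j) ≥ (7/8)·j)
  have hjn : (2 : ℚ) ^ (emin + p - 1) ≤ j :=
    (zpow_le_zpow_right₀ (by norm_num) (by omega)).trans hjn'
  have hyn : (2 : ℚ) ^ (emin + p - 1) ≤ y := by
    have h1 : ulp p emin j ≤ |j| / 2 ^ (p - 1) :=
      ulp_le_of_normal hp1 (by rw [abs_of_pos hj0]; exact hjn)
    rw [abs_of_pos hj0] at h1
    have h8 : (8 : ℚ) ≤ 2 ^ (p - 1) := by
      have : (2 : ℚ) ^ 3 ≤ 2 ^ (p - 1) := pow_le_pow_right₀ (by norm_num) (by omega)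
      norm_num at this; exact this
    have h3 : ulp p emin j ≤ j / 8 := h1.trans (div_le_div_of_nonneg_left hj0.le (by norm_num) h8)
    have h4 : (2 : ℚ) ^ (emin + p - 1) = 2 ^ (emin + p) / 2 := by
      rw [eq_div_iff (ne_of_gt h2), ← zpow_add_one₀ (ne_of_gt h2)]; congr 1; ring
    have ejy := abs_lt.mp hB₃lt
    rw [h4]; linarith [ejy.2]
  -- grid pinning: two rigid configurations
  have key : (i' + j = -ulp p emin j ∧ ∃ a : ℤ, ulp p emin j = (2 : ℚ) ^ a) ∨
      (i' + j = ulp p emin y ∧ ulp p emin j = 2 * ulp p emin y ∧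
        ∃ b : ℤ, ulp p emin y = (2 : ℚ) ^ b) := by
    rcases lt_or_ge (ulp p emin j) (ulp p emin y) with hjy | hyj
    · left
      obtain ⟨-, -, hd⟩ := grid_pin_float hp2 hFj hFy hj0 hy0 hjn hyn hne' (hB₃lt.trans hjy)
      obtain ⟨a, -, ha⟩ := exists_ulp_eq_two_zpow (p := p) (emin := emin) j
      refine ⟨?_, a, ha⟩
      rw [hy] at hd; linarith
    · right
      have hlt' : |y - j| < ulp p emin j := by rwa [abs_sub_comm]
      obtain ⟨hU, -, hd⟩ := grid_pin_float hp2 hFy hFj hy0 hj0 hyn hjn hne'.symm hlt'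
      obtain ⟨b, -, hb⟩ := exists_ulp_eq_two_zpow (p := p) (emin := emin) y
      refine ⟨?_, hU, b, hb⟩
      rw [hy] at hd; linarith
  -- the common contradiction: a float strictly between `w = B₀ + B₁` and `fl w = −B₃`
  have hmin : ∀ f : ℚ, IsFloat p emin f → |w - -(i' + j)| ≤ |w - f| := by
    intro f hf
    have h := abs_sub_fl_le hfl w hf
    rwa [hQ] at h
  have hw_le : |w| ≤ |B₀| + |B₁| := abs_add_le _ _
  have hwG : OnGrid emin w := by
    obtain ⟨K₀, hK₀⟩ := hFB₀.exists_int_mul_zpow_emin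
    obtain ⟨K₁, hK₁⟩ := hFB₁.exists_int_mul_zpow_emin
    exact ⟨K₀ + K₁, by rw [hw, hK₀, hK₁]; push_cast; ring⟩
  have hpp : (2 : ℚ) ^ (emin + p - 1) ≤ 2 ^ (emin + p) :=
    zpow_le_zpow_right₀ (by norm_num) (by omega)
  rcases key with ⟨hB3, a, ha⟩ | ⟨hB3, hU, b, hb⟩
  · -- B₃ = −V, V = ulp j = 2^a
    have hV0 : (0 : ℚ) < 2 ^ a := zpow_pos h2 a
    have hwV : |w| < 11 / 16 * 2 ^ a := by
      have : |B₁| ≤ 2 ^ a / 2 := by rw [← ha]; exact hB₁z.trans hz₀j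
      rw [ha] at hB₀j; linarith
    rcases le_or_gt emin (a - p) with hap | hap
    · -- V ≥ 2^(emin+p): the candidate f = V − 2^(a−p) = (2^p − 1)·2^(a−p) is a float
      have hf : IsFloat p emin (((2 ^ p - 1 : ℤ) : ℚ) * 2 ^ (a - p)) := by
        refine isFloat_of_int_mul _ _ ?_ hap
        rw [abs_of_nonneg (by have := one_le_pow₀ (M₀ := ℤ) (a := 2) (n := p) (by norm_num); omega)]
        omega
      have hfval : ((2 ^ p - 1 : ℤ) : ℚ) * 2 ^ (a - p) = 2 ^ a - u * 2 ^ a := by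
        rw [hu]; unfold unitRoundoff
        rw [zpow_sub₀ (ne_of_gt h2), zpow_natCast]; push_cast
        field_simp
      have h := hmin _ hf
      rw [hfval, hB3, neg_neg, ha] at h
      -- |w| < (11/16) V and u V ≤ V/16
      have huV : u * 2 ^ a ≤ 1 / 16 * 2 ^ a := mul_le_mul_of_nonneg_right hu16 hV0.le
      have huV0 : 0 < u * 2 ^ a := mul_pos hu0 hV0
      have ew := abs_le.mp (le_refl |w|)
      rw [abs_of_nonpos (by linarith : w - 2 ^ a ≤ 0),
        abs_of_nonpos (by linarith : w - (2 ^ a - u * 2 ^ a) ≤ 0)] at h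
      linarith
    · -- V ≤ 2^(emin+p−1) (low range): w lies on the grid 2^emin below 2^(emin+p), so it is a
      -- float and fl w = w; but fl w = V while |w| < (11/16)·V
      have hVle : (2 : ℚ) ^ a ≤ 2 ^ (emin + p - 1) := zpow_le_zpow_right₀ (by norm_num) (by omega)
      have hFw : IsFloat p emin w :=
        isFloat_of_onGrid_of_abs_lt hwG (by linarith [abs_nonneg w])
      have hwe : w = 2 ^ a := by rw [← fl_eq_self hfl hFw, hQ, hB3, neg_neg, ha]
      rw [hwe, abs_of_pos hV0] at hwV
      linarith
  · -- B₃ = W = ulp y = 2^b, ulp j = 2W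
    have hW0 : (0 : ℚ) < 2 ^ b := zpow_pos h2 b
    have hwW : |w| < 7 / 8 * 2 ^ b := by
      have h1 : |B₁| ≤ 2 ^ b / 2 := by
        have : ulp p emin i' = ulp p emin y := by rw [hy, ulp_neg]
        rw [← hb, ← this]; exact hB₁i'
      rw [hU, hb] at hB₀j; linarith
    rcases le_or_gt emin (b - p) with hbp | hbp
    · -- W ≥ 2^(emin+p): the candidate f = −(W − 2^(b−p)) is a float
      have hf : IsFloat p emin (((-(2 ^ p - 1) : ℤ) : ℚ) * 2 ^ (b - p)) := by
        refine isFloat_of_int_mul _ _ ?_ hbp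
        rw [abs_neg,
          abs_of_nonneg (by have := one_le_pow₀ (M₀ := ℤ) (a := 2) (n := p) (by norm_num); omega)]
        omega
      have hfval : ((-(2 ^ p - 1) : ℤ) : ℚ) * 2 ^ (b - p) = -(2 ^ b - u * 2 ^ b) := by
        rw [hu]; unfold unitRoundoff
        rw [zpow_sub₀ (ne_of_gt h2), zpow_natCast]; push_cast
        field_simp
      have h := hmin _ hf
      rw [hfval, hB3, hb] at h
      have huW : u * 2 ^ b ≤ 1 / 16 * 2 ^ b := mul_le_mul_of_nonneg_right hu16 hW0.le
      have huW0 : 0 < u * 2 ^ b := mul_pos hu0 hW0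
      have ew := abs_le.mp (le_refl |w|)
      rw [abs_of_nonneg (by linarith : 0 ≤ w - -(2 ^ b)),
        abs_of_nonneg (by linarith : 0 ≤ w - -(2 ^ b - u * 2 ^ b))] at h
      linarith
    · -- W ≤ 2^(emin+p−1) (low range): w is a float, fl w = w = −W; but |w| < (7/8)·W
      have hWle : (2 : ℚ) ^ b ≤ 2 ^ (emin + p - 1) := zpow_le_zpow_right₀ (by norm_num) (by omega)
      have hFw : IsFloat p emin w :=
        isFloat_of_onGrid_of_abs_lt hwG (by linarith [abs_nonneg w])
      have hwe : w = -(2 ^ b) := by rw [← fl_eq_self hfl hFw, hQ, hB3, hb]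
      rw [hwe, abs_neg, abs_of_pos hW0] at hwW
      linarith

/-- **BLOCK FORM.** Error-free two-products of floats, both rounded products POSITIVE (no range
threshold), `estimate` of the (nonoverlapping) TWO-TWO-DIFF block equal to `0` ⟹ the exact
difference of the products is `0` (`p ≥ 4`, round-to-nearest with `RoundoffBelow 2`). -/
theorem twoTwoProdDiff_estimate_eq_zero_sum_pos (hp : 4 ≤ p) (hfl : IsRoundNearest p emin fl)
    (hfl2 : RoundoffBelow 2 fl) {tp : ℚ → ℚ → ℚ × ℚ} {x₁ x₂ x₃ x₄ : ℚ}
    (h₁₂ : ExactTwoProd p emin fl tp x₁ x₂) (h₃₄ : ExactTwoProd p emin fl tp x₃ x₄)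
    (hA : 0 < fl (x₁ * x₂)) (hB : 0 < fl (x₃ * x₄))
    (hz : estimate fl (twoTwoProdDiff tp fl x₁ x₂ x₃ x₄) = 0) : x₁ * x₂ - x₃ * x₄ = 0 := by
  have hp1 : 1 ≤ p := (by omega); have hp2 : 2 ≤ p := by omega
  obtain ⟨hW, hS, -, -⟩ := twoTwoProdDiff_spec hp1 hfl hfl2 h₁₂ h₃₄
  rw [← hS]
  obtain ⟨hA1, hAs, hFa⟩ := h₁₂
  obtain ⟨hB1, hBs, hFb⟩ := h₃₄
  unfold twoTwoProdDiff at hW hz ⊢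
  obtain ⟨B₀, B₁, B₃, hBlk, hQ, hF₀, hF₁, -, -⟩ :=
    twoTwoDiff_estimate_eq_zero hp2 hfl hW.isExpansion hz
  rw [hBlk]
  simp only [List.sum_cons, List.sum_nil, add_zero]
  set A := (tp x₁ x₂).1 with hAdef
  set a₀ := (tp x₁ x₂).2 with ha₀def
  set B := (tp x₃ x₄).1 with hBdef
  set b₀ := (tp x₃ x₄).2 with hb₀def
  have hFA : IsFloat p emin A := by rw [hA1]; exact (hfl _).1
  have hFB : IsFloat p emin B := by rw [hB1]; exact (hfl _).1
  have hAe : fl (A + a₀) = A := by rw [hAs, ← hA1]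
  have hBe : fl (B + b₀) = B := by rw [hBs, ← hB1]
  rw [← hA1] at hA
  rw [← hB1] at hB
  -- the chain
  rw [twoTwoDiff_eq] at hBlk
  simp only [List.cons.injEq, and_true] at hBlk
  obtain ⟨e1, e2, e3, e4⟩ := hBlk
  set i := (twoSum fl (-b₀) a₀).1 with hidef
  set j := (twoSum fl i A).1 with hjdef
  have hFi : IsFloat p emin i := (isFloat_twoSum hfl (-b₀) a₀).1
  have hz₀ : (twoSum fl i A).2 = i + A - j := by
    rw [(twoSum_exact hp1 hfl hFi hFA).1, hjdef, twoSum_fst]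
  rw [hz₀] at e2 e3 e4
  set i' := (twoSum fl (-B) (i + A - j)).1 with hi'def
  have hFi' : IsFloat p emin i' := (isFloat_twoSum hfl (-B) (i + A - j)).1
  have hFj : IsFloat p emin j := (isFloat_twoSum hfl i A).1
  have hFz : IsFloat p emin (i + A - j) := hz₀ ▸ (isFloat_twoSum hfl i A).2
  -- B₃ = i' + j (the top TWO-SUM is exact since its roundoff B₂ is 0)
  have hB₃ : B₃ = i' + j := by
    have h := (twoSum_exact hp1 hfl hFi' hFj).2
    rw [e3, e4, add_zero] at h
    exact h
  have hB₀ : B₀ = -b₀ + a₀ - i := by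
    rw [← e1, (twoSum_exact hp1 hfl hFb.neg hFa).1, hidef, twoSum_fst]
  have hB₁ : B₁ = -B + (i + A - j) - i' := by
    rw [← e2, (twoSum_exact hp1 hfl hFB.neg hFz).1, hi'def, twoSum_fst]
  have hcore : i' + j = 0 := by
    refine tailsZero_core_pos (i := i) (j := j) (i' := i') hp hfl hFA hFa hFB hFb hAe hBe hA hB
      (by rw [hidef, twoSum_fst]) (by rw [hjdef, twoSum_fst]) (by rw [hi'def, twoSum_fst]) ?_
    rw [← hB₀, ← hB₁, hQ, hB₃]
  have hB₃0 : B₃ = 0 := by rw [hB₃, hcore]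
  rw [hB₃0, neg_zero] at hQ
  have := add_eq_zero_of_fl_add_eq_zero hp1 hfl hF₀ hF₁ hQ
  linarith

/-- **ORIENT2D, THE TAILS-ZERO EXIT (any range).** If the four coordinate differences are floats
(so `orient2dadapt` returns `det = estimate(4, B)` right after stage B), the two-products are
error-free, both rounded products are positive, and the returned `det` is `0`, then the TRUE
determinant is `0` (`p ≥ 4`, round-to-nearest with `RoundoffBelow 2`). -/
theorem orient2d_tailsZero_det_eq_zero_pos (hp : 4 ≤ p) (hfl : IsRoundNearest p emin fl)
    (hfl2 : RoundoffBelow 2 fl) {tp : ℚ → ℚ → ℚ × ℚ} {a₁ a₂ b₁ b₂ c₁ c₂ : ℚ}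
    (h₁ : IsFloat p emin (a₁ - c₁)) (h₂ : IsFloat p emin (b₂ - c₂)) (h₃ : IsFloat p emin (a₂ - c₂))
    (h₄ : IsFloat p emin (b₁ - c₁)) (h₁₂ : ExactTwoProd p emin fl tp (a₁ - c₁) (b₂ - c₂))
    (h₃₄ : ExactTwoProd p emin fl tp (a₂ - c₂) (b₁ - c₁))
    (hA : 0 < fl ((a₁ - c₁) * (b₂ - c₂))) (hB : 0 < fl ((a₂ - c₂) * (b₁ - c₁)))
    (hz : orient2dDetB tp fl a₁ a₂ b₁ b₂ c₁ c₂ = 0) :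
    (a₁ - c₁) * (b₂ - c₂) - (a₂ - c₂) * (b₁ - c₁) = 0 := by
  unfold orient2dDetB at hz
  rw [fl_eq_self hfl h₁, fl_eq_self hfl h₂, fl_eq_self hfl h₃, fl_eq_self hfl h₄] at hz
  exact twoTwoProdDiff_estimate_eq_zero_sum_pos hp hfl hfl2 h₁₂ h₃₄ hA hB hz

end Summit.Ventures.CertifiedArithmetic.Expansions
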